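import Summits.Ventures.Crystal3D.Theorems.StickyWulffConstantTextureLiminfTexShadowSteepPlateLaunchCore
import HarnessLib

/-!
# TexShadow row (e) / EDGE-ON (ε₂): a steep plate is NOT steep in its twin presentation — the six slot/capper directions cover the half-sphere at 60°
# (lane T, crux `TextureLiminfV5`, stmt-Ventures-23912, sub-crux EDGE-ON; corollary of cf-p1 (cxxxvii)(2)(b); memo HOME/wall-p1-g15/STEEP-PLATE-g15.md §5)

HONEST FRAMING. Venture `Summits/Ventures/Crystal3D` (cell `crystal3d-full`), route `route-Ventures-StickyWulffConstant`, helper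
`--supports` the law-v5 crux `TextureLiminfV5` (stmt-Ventures-23912).  PROOFS ONLY (elementary real geometry); NO certificate is asserted;
nothing about any wall law is proved; rung F-C1 not moved.

THE POINT.  `SteepPlateAt c L e` (p706442; = the launch-failure set of the steered ledgers, p707977) asks that the three reference up-slots
`u_k` of the up-presentation ALL rise by `< steerSteepCos c` along `e`.  A faulted plate can also be presented by its TWIN frame (the other bilayer
orientation as reference: frame `L ∘ Rot_π(e₃)`, word `−σ`; lane T's re-presentation glue `bilayerWallAt_of_represented₁/₂`), whose reference
up-slots are the former cappers `T_k = −basalMirror u_k`.  The six unit vectors `{u₁, u₂, u₃, T₁, T₂, T₃}` sit at polar angle `arccos √(2/3)`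
with azimuths every `60°`; their covering radius on the closed upper half-sphere is EXACTLY `60°`:
* **`exists_slot_or_capper_inner_ge_half`** — for every unit `ν` with `ν₂ ≥ 0` some reference up-slot `v` has `⟪v, ν⟫ ≥ 1/2` or `−⟪basalMirror v, ν⟫ ≥ 1/2`
  (in the coordinates `P_k = ⟪p_k, ν_h⟫`, `ΣP_k = 0`, `2ΣP_k² + ν₂² = 1`: `max_k |P_k| ≥ √(1 − ν₂²)/2`, and `√(1−h²)/2 + √(2/3)·h ≥ 1/2`);
* **`exists_capper_rise_ge_of_steepPlateAt`** — hence if `steerSteepCos c ≤ 1/2` (every chord `c ≥ 0.2611`; the chord of record `1/3` has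
  `steerSteepCos (1/3) = (17√2 − √70)/36 < 1/2`, `steerSteepCos_third_lt_half`) a STEEP plate has a capper direction rising by `≥ steerSteepCos c`:
  its twin presentation is NOT steep, so (by `exists_steerLaunchAt_of_not_steepPlateAt` applied to the twin frame) it launches a steered family from the
  twin presentation.  CONSEQUENCE (memo §5): under a two-sided steered ledger that may launch each plate from either presentation, the steep-plate
  corner is EMPTY at chord `1/3`; what remains of the EDGE-ON regime is sep/read (twin-chain misorientations) and flux-sum shortfalls.
* (appended) `inner_upFrame_twinPresentation` (the twin presentation as the frame `(basalMirror ≫ −id) ≫ L`: its slot rises are `L`'s capper rises),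
  `not_steepPlateAt_twin_of_steepPlateAt`, `not_steepPlateAt_or_not_steepPlateAt_twin_third` (every plate is non-steep in SOME presentation at chord 1/3).
WHAT THIS IS NOT: no certificate; the represented two-sided families are not typed here (lane G/T); F-C1 not moved.
-/

noncomputable section

open scoped BigOperators InnerProductSpace ENNReal
open MeasureTheory Filter

namespace Summit.Ventures.Crystal3D.Cruxes.TextureLiminf.TexShadow

open Summit.Ventures.Crystal3D Summit.Ventures.Crystal3D.Theorems
open Literature.MathematicalPhysics.StatisticalMechanics (IsHaggSeq fccStacking barlowStacking basalMirror)

/-- `steerSteepCos (1/3) < 1/2` (`(17√2 − √70)/36 ≈ 0.4354`). -/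
theorem steerSteepCos_third_lt_half : steerSteepCos (1 / 3) < 1 / 2 := by
  rw [steerSteepCos_third]
  have h2 : Real.sqrt 2 ≤ 1.4143 := by
    rw [show (1.4143 : ℝ) = Real.sqrt (1.4143 ^ 2) by rw [Real.sqrt_sq (by norm_num)]]
    exact Real.sqrt_le_sqrt (by norm_num)
  have h70 : (8.366 : ℝ) ≤ Real.sqrt 70 := by
    rw [show (8.366 : ℝ) = Real.sqrt (8.366 ^ 2) by rw [Real.sqrt_sq (by norm_num)]]
    exact Real.sqrt_le_sqrt (by norm_num)
  linarith

/-- **Core inequality of the 60° covering**: reals `P₁ + P₂ + P₃ = 0`, `2(P₁² + P₂² + P₃²) + h² = 1`, `h ≥ 0` ⇒ some `±P_k + √(2/3)·h ≥ 1/2`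
(the largest `|P_k|` is `≥ √(1 − h²)/2`, and `√(1−h²)/2 + √(2/3) h ≥ 1/2` on `[0, 1]`). -/
theorem six_cover_core (P₁ P₂ P₃ h : ℝ) (hsum : P₁ + P₂ + P₃ = 0) (hsph : 2 * (P₁ ^ 2 + P₂ ^ 2 + P₃ ^ 2) + h ^ 2 = 1) (hh : 0 ≤ h) :
    (1 / 2 : ℝ) ≤ P₁ + Real.sqrt (2 / 3) * h ∨ (1 / 2 : ℝ) ≤ -P₁ + Real.sqrt (2 / 3) * h ∨
    (1 / 2 : ℝ) ≤ P₂ + Real.sqrt (2 / 3) * h ∨ (1 / 2 : ℝ) ≤ -P₂ + Real.sqrt (2 / 3) * h ∨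
    (1 / 2 : ℝ) ≤ P₃ + Real.sqrt (2 / 3) * h ∨ (1 / 2 : ℝ) ≤ -P₃ + Real.sqrt (2 / 3) * h := by
  have hq2 : Real.sqrt (2 / 3) ^ 2 = 2 / 3 := Real.sq_sqrt (by norm_num)
  have hq0 : 0 ≤ Real.sqrt (2 / 3) := Real.sqrt_nonneg _
  have hqh : 0 ≤ Real.sqrt (2 / 3) * h := mul_nonneg hq0 hh
  -- the claim for a number `M ≥ 0` with `M² ≥ (1 − h²)/4`
  have key : ∀ M : ℝ, 0 ≤ M → 1 - h ^ 2 ≤ 4 * M ^ 2 → (1 / 2 : ℝ) ≤ M + Real.sqrt (2 / 3) * h := by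
    intro M hM hM2
    by_contra hcon
    have hlt : M + Real.sqrt (2 / 3) * h < 1 / 2 := lt_of_not_ge hcon
    have hM' : M < 1 / 2 - Real.sqrt (2 / 3) * h := by linarith
    have hpos : 0 < 1 / 2 - Real.sqrt (2 / 3) * h := by linarith
    have hsq : M ^ 2 < (1 / 2 - Real.sqrt (2 / 3) * h) ^ 2 := by
      rw [sq, sq]; exact mul_self_lt_mul_self hM hM'
    -- (1 − h²)/4 < 1/4 − √(2/3) h + (2/3) h², i.e. √(2/3) h < (11/12) h², impossible for 0 ≤ h with √(2/3)h < 1/2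
    have hq8 : (0.8 : ℝ) ≤ Real.sqrt (2 / 3) := by
      rw [show (0.8 : ℝ) = Real.sqrt (0.8 ^ 2) by rw [Real.sqrt_sq (by norm_num)]]
      exact Real.sqrt_le_sqrt (by norm_num)
    nlinarith [mul_nonneg hh (by linarith : (0 : ℝ) ≤ Real.sqrt (2 / 3) - 0.8)]
  -- some P_k² dominates the other two: among the three pairwise products one is ≥ 0 (three reals cannot be pairwise of opposite signs)
  have fin : ∀ P Q R : ℝ, P + Q + R = 0 → 2 * (P ^ 2 + Q ^ 2 + R ^ 2) + h ^ 2 = 1 → 0 ≤ P * Q →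
      (1 / 2 : ℝ) ≤ R + Real.sqrt (2 / 3) * h ∨ (1 / 2 : ℝ) ≤ -R + Real.sqrt (2 / 3) * h := by
    intro P Q R hs hsp hPQ
    have hR : R = -(P + Q) := by linarith
    have hR2 : P ^ 2 + Q ^ 2 ≤ R ^ 2 := by rw [hR]; nlinarith
    have hM2 : 1 - h ^ 2 ≤ 4 * |R| ^ 2 := by rw [sq_abs]; nlinarith
    rcases le_or_gt 0 R with hp | hp
    · left; have := key |R| (abs_nonneg _) hM2; rwa [abs_of_nonneg hp] at this
    · right; have := key |R| (abs_nonneg _) hM2; rwa [abs_of_neg hp] at this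
  rcases le_or_gt 0 (P₁ * P₂) with h12 | h12
  · rcases fin P₁ P₂ P₃ hsum hsph h12 with h | h
    · exact Or.inr (Or.inr (Or.inr (Or.inr (Or.inl h))))
    · exact Or.inr (Or.inr (Or.inr (Or.inr (Or.inr h))))
  · rcases le_or_gt 0 (P₁ * P₃) with h13 | h13
    · have hsum' : P₁ + P₃ + P₂ = 0 := by linarith
      have hsph' : 2 * (P₁ ^ 2 + P₃ ^ 2 + P₂ ^ 2) + h ^ 2 = 1 := by linarith
      rcases fin P₁ P₃ P₂ hsum' hsph' h13 with h | h
      · exact Or.inr (Or.inr (Or.inl h))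
      · exact Or.inr (Or.inr (Or.inr (Or.inl h)))
    · -- P₁P₂ < 0 and P₁P₃ < 0 ⇒ P₂P₃ > 0
      have h23 : 0 ≤ P₂ * P₃ := by
        have hprod : 0 < (P₁ * P₂) * (P₁ * P₃) := mul_pos_of_neg_of_neg h12 h13
        by_contra hcon
        have hlt : P₂ * P₃ < 0 := lt_of_not_ge hcon
        have : (P₁ * P₂) * (P₁ * P₃) = P₁ ^ 2 * (P₂ * P₃) := by ring
        rw [this] at hprod
        have : P₁ ^ 2 * (P₂ * P₃) ≤ 0 := mul_nonpos_of_nonneg_of_nonpos (sq_nonneg _) hlt.le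
        linarith
      have hsum' : P₂ + P₃ + P₁ = 0 := by linarith
      have hsph' : 2 * (P₂ ^ 2 + P₃ ^ 2 + P₁ ^ 2) + h ^ 2 = 1 := by linarith
      rcases fin P₂ P₃ P₁ hsum' hsph' h23 with h | h
      · exact Or.inl h
      · exact Or.inr (Or.inl h)

/-- **The six slot/capper directions cover the upper half-sphere at 60°**: for every unit model axis `ν` with `ν₂ ≥ 0` some reference up-slot
`v ∈ {upSlot₁, upSlot₂, upSlot₃}` has `⟪v, ν⟫ ≥ 1/2` OR its capper direction has `−⟪basalMirror v, ν⟫ ≥ 1/2` (equality on the equator midway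
between a slot azimuth and a capper azimuth). -/
theorem exists_slot_or_capper_inner_ge_half (ν : E3) (hν : ‖ν‖ = 1) (hν2 : 0 ≤ ν 2) :
    ∃ v ∈ fccSlots, v 2 = Real.sqrt (2 / 3) ∧ ((1 / 2 : ℝ) ≤ ⟪v, ν⟫_ℝ ∨ (1 / 2 : ℝ) ≤ -⟪basalMirror v, ν⟫_ℝ) := by
  obtain ⟨hu1, hu2, hu3⟩ := upSlots_mem_fccSlots
  have h3 : Real.sqrt 3 ^ 2 = 3 := Real.sq_sqrt (by norm_num)
  have hunit : ν 0 ^ 2 + ν 1 ^ 2 + ν 2 ^ 2 = 1 := by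
    have h := real_inner_self_eq_norm_sq ν
    have h' : ∀ a b : E3, ⟪a, b⟫_ℝ = a 0 * b 0 + a 1 * b 1 + a 2 * b 2 := fun a b => by
      simp [PiLp.inner_apply, Fin.sum_univ_three, mul_comm]
    rw [hν, one_pow, h'] at h
    linear_combination h
  obtain ⟨s1, s2, s3⟩ := inner_upSlot_fin3 ν
  obtain ⟨n1, n2, n3⟩ := inner_basalMirror_upSlot_fin3 ν
  have hsum : (1 / 2 * ν 0 + Real.sqrt 3 / 6 * ν 1) + (-(1 / 2) * ν 0 + Real.sqrt 3 / 6 * ν 1) + (-(Real.sqrt 3 / 3) * ν 1) = 0 := by ring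
  have hsph : 2 * ((1 / 2 * ν 0 + Real.sqrt 3 / 6 * ν 1) ^ 2 + (-(1 / 2) * ν 0 + Real.sqrt 3 / 6 * ν 1) ^ 2 +
      (-(Real.sqrt 3 / 3) * ν 1) ^ 2) + ν 2 ^ 2 = 1 := by
    linear_combination hunit + (ν 1 ^ 2 / 3) * h3
  rcases six_cover_core _ _ _ (ν 2) hsum hsph hν2 with h | h | h | h | h | h
  · exact ⟨upSlot₁, hu1, upSlot₁_coord.2.2, Or.inl (by rw [s1]; linarith)⟩
  · exact ⟨upSlot₁, hu1, upSlot₁_coord.2.2, Or.inr (by rw [n1]; linarith)⟩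
  · exact ⟨upSlot₂, hu2, upSlot₂_coord.2.2, Or.inl (by rw [s2]; linarith)⟩
  · exact ⟨upSlot₂, hu2, upSlot₂_coord.2.2, Or.inr (by rw [n2]; linarith)⟩
  · exact ⟨upSlot₃, hu3, upSlot₃_coord.2.2, Or.inl (by rw [s3]; linarith)⟩
  · exact ⟨upSlot₃, hu3, upSlot₃_coord.2.2, Or.inr (by rw [n3]; linarith)⟩

/-- **A steep plate is not steep in its twin presentation** (`steerSteepCos c ≤ 1/2`, e.g. the chord of record `1/3`): if every reference up-slot of
`upFrame L e` rises by `< steerSteepCos c` along the unit axis `e`, then some CAPPER direction `−(upFrame L e)(basalMirror v)` — a reference up-slot of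
the twin presentation — rises by `≥ 1/2 ≥ steerSteepCos c`. -/
theorem exists_capper_rise_ge_of_steepPlateAt {c : ℝ} {L : E3 ≃ₗᵢ[ℝ] E3} {e : E3} (hc : steerSteepCos c ≤ 1 / 2) (he : ‖e‖ = 1)
    (h : SteepPlateAt c L e) :
    ∃ v ∈ fccSlots, v 2 = Real.sqrt (2 / 3) ∧ steerSteepCos c ≤ -⟪upFrame L e (basalMirror v), e⟫_ℝ := by
  have hνn : ‖(upFrame L e).symm e‖ = 1 := by rw [LinearIsometryEquiv.norm_map, he]
  have hν2 : 0 ≤ ((upFrame L e).symm e) 2 := upFrame_axis_nonneg L e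
  obtain ⟨v, hv, hv2, hor⟩ := exists_slot_or_capper_inner_ge_half _ hνn hν2
  refine ⟨v, hv, hv2, ?_⟩
  rcases hor with hs | hcap
  · -- the slot disjunct contradicts steepness
    have hlt := h v hv hv2
    rw [inner_map_eq_inner_symm] at hlt
    exact absurd (hc.trans hs) (not_le.2 hlt)
  · rw [inner_map_eq_inner_symm]; exact hc.trans hcap

/-- The chord of record: a plate steep at chord `1/3` has a capper direction rising by `≥ (17√2 − √70)/36`. -/
theorem exists_capper_rise_ge_of_steepPlateAt_third {L : E3 ≃ₗᵢ[ℝ] E3} {e : E3} (he : ‖e‖ = 1) (h : SteepPlateAt (1 / 3) L e) :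
    ∃ v ∈ fccSlots, v 2 = Real.sqrt (2 / 3) ∧ steerSteepCos (1 / 3) ≤ -⟪upFrame L e (basalMirror v), e⟫_ℝ :=
  exists_capper_rise_ge_of_steepPlateAt steerSteepCos_third_lt_half.le he h


/-! ## The twin presentation as a frame (appended 2026-08-29, 19480-p1 g15) -/

/-- **Rises of the twin presentation.**  The TWIN PRESENTATION of a plate frame `L` is the frame `Lʷ := (basalMirror ≫ (−id)) ≫ L`, `x ↦ −L(basalMirror x)`
(the model rotated by `π` about its basal normal: the other bilayer orientation as reference, word `−σ`; its stacking is the same point set).  Its model axis has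
the same third coordinate, and the `e`-rise of its reference up-slot `v` is the rise of `L`'s capper direction: `⟪upFrame Lʷ e v, e⟫ = −⟪upFrame L e (basalMirror v), e⟫`. -/
theorem inner_upFrame_twinPresentation (L : E3 ≃ₗᵢ[ℝ] E3) (e v : E3) :
    ⟪upFrame ((basalMirror.trans (LinearIsometryEquiv.neg ℝ)).trans L) e v, e⟫_ℝ = -⟪upFrame L e (basalMirror v), e⟫_ℝ := by
  have hbb : ∀ x : E3, basalMirror (basalMirror x) = x := Literature.MathematicalPhysics.StatisticalMechanics.basalMirror_basalMirror
  have happ : ∀ x : E3, ((basalMirror.trans (LinearIsometryEquiv.neg ℝ)).trans L) x = -L (basalMirror x) := by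
    intro x
    simp only [LinearIsometryEquiv.trans_apply, LinearIsometryEquiv.coe_neg]
    exact map_neg L _
  have hsymm : ((basalMirror.trans (LinearIsometryEquiv.neg ℝ)).trans L).symm e = basalMirror (-(L.symm e)) := by
    apply ((basalMirror.trans (LinearIsometryEquiv.neg ℝ)).trans L).injective
    rw [LinearIsometryEquiv.apply_symm_apply, happ, hbb, map_neg, neg_neg, LinearIsometryEquiv.apply_symm_apply]
  have h2 : (((basalMirror.trans (LinearIsometryEquiv.neg ℝ)).trans L).symm e) 2 = (L.symm e) 2 := by
    rw [hsymm, Literature.MathematicalPhysics.StatisticalMechanics.basalMirror_apply_coord]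
    simp
  unfold upFrame
  rw [h2]
  split_ifs with h
  · rw [happ, inner_neg_left]
  · simp only [LinearIsometryEquiv.trans_apply, LinearIsometryEquiv.coe_neg, hbb, map_neg, inner_neg_left]

/-- **A steep plate is NOT steep in its twin presentation** (`steerSteepCos c ≤ 1/2`, unit axis): with `Lʷ = (basalMirror ≫ (−id)) ≫ L`,
`SteepPlateAt c L e → ¬ SteepPlateAt c Lʷ e`.  Hence (with `exists_steerLaunchAt_of_not_steepPlateAt`, p707977) every plate launches a steered family
from one of its two presentations at chord `1/3`. -/
theorem not_steepPlateAt_twin_of_steepPlateAt {c : ℝ} {L : E3 ≃ₗᵢ[ℝ] E3} {e : E3} (hc : steerSteepCos c ≤ 1 / 2) (he : ‖e‖ = 1)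
    (h : SteepPlateAt c L e) : ¬ SteepPlateAt c ((basalMirror.trans (LinearIsometryEquiv.neg ℝ)).trans L) e := by
  obtain ⟨v, hv, hv2, hge⟩ := exists_capper_rise_ge_of_steepPlateAt hc he h
  intro hw
  have hlt := hw v hv hv2
  rw [inner_upFrame_twinPresentation] at hlt
  exact absurd hge (not_le.2 hlt)

/-- **Presentation dichotomy at the chord of record**: for every frame `L` and unit axis `e`, the plate is not steep at chord `1/3` in its given
presentation OR not steep in its twin presentation — some presentation launches. -/
theorem not_steepPlateAt_or_not_steepPlateAt_twin_third (L : E3 ≃ₗᵢ[ℝ] E3) {e : E3} (he : ‖e‖ = 1) :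
    ¬ SteepPlateAt (1 / 3) L e ∨ ¬ SteepPlateAt (1 / 3) ((basalMirror.trans (LinearIsometryEquiv.neg ℝ)).trans L) e := by
  by_cases h : SteepPlateAt (1 / 3) L e
  · exact Or.inr (not_steepPlateAt_twin_of_steepPlateAt steerSteepCos_third_lt_half.le he h)
  · exact Or.inl h
end Summit.Ventures.Crystal3D.Cruxes.TextureLiminf.TexShadow

end
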